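import Summits.ResolutionOfSingularities.ResolutionOfSingularities.Theorems.FrobeniusLadderFRationalResolutionIsolatedAffineLogRegularChartResolution
import HarnessLib

/-!
# Crux `FrobeniusLadder.FRationalResolution` (stmt-ResolutionOfSingularities-15317), line `redirect`,
# stub `stub_diagonalizableQuotientResolution` — the isolated-singularity assemblies (ε₂′)/(ε₂″) over an ARBITRARY ground field,
# with the residue condition `κ(x) = κ(y)` of brick E-k as a hypothesis

`…IsolatedFixedChartResolution` (ε₂′ ✓ p824253) and `…IsolatedAffineLogRegularChartResolution` (ε₂″ ✓ p824766 / p825673) were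
stated over an algebraically closed field only because there the residue condition of brick E-k
(`…EtaleChartPrimaryCentre.hasResolution_of_isolated_etale_primaryBlowup`: the stalk map `𝒪_{X,φ y} → κ(y)` is onto) is automatic.
Here the same two assemblies are run over ANY field with that condition carried as a hypothesis at each chart point (it holds, e.g.,
at `K`-rational chart points over `K`-rational singular points). Proofs are those of the cited files verbatim, with the general E-k.

* `hasResolution_of_isolated_logRegular_fixed_charts` — (ε₂′) over any field;
* **`hasResolution_of_isolated_affine_logRegular_charts`** — (ε₂″, no dimension hypothesis) over any field.

Honest label: assembly (no stub closed by name). No definitions, no named facts, no sorry.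
[cite: Kato1994, Def. (2.1), (10.4)] [cite: KempfEtAl1973, Ch. I §2 Thm. 11] [cite: Kollar2007, §2.2]
-/

noncomputable section

-- single-problem summit: the doubled namespace component is forced
set_option linter.dupNamespace false

open CategoryTheory AlgebraicGeometry TopologicalSpace
open Literature.AlgebraicGeometry.Resolution Literature.Geometry.PolyhedralFans
open Literature.AlgebraicGeometry.Resolution.LogBlowup Literature.AlgebraicGeometry.Resolution.LogChart
open Summit.ResolutionOfSingularities.ResolutionOfSingularities.Theorems.FRationalResolution

namespace Summit.ResolutionOfSingularities.ResolutionOfSingularities.Theorems.FRationalResolution.IsolatedChartResolutionField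

/-- **(ε₂′, any field) Isolated singularities that are étale-locally fixed points of log regular charts WITH TRIVIAL RESIDUE
EXTENSION are resolvable.** As `…IsolatedFixedChartResolution.hasResolution_of_isolated_logRegular_fixed_charts_of_isAlgClosed`, over
an arbitrary field `K`, with the extra hypothesis that `𝒪_{X,φ y} → κ(y)` is onto at each chart point. [cite: Kato1994, (10.4)]
[cite: KempfEtAl1973, Ch. I §2 Thm. 11] [cite: Kollar2007, §2.2] -/
theorem hasResolution_of_isolated_logRegular_fixed_charts (K : Type) [Field K]
    (X : Scheme.{0}) [IsIntegral X] (f : X ⟶ Spec (.of K)) [LocallyOfFiniteType f]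
    (hfin : (Scheme.regularLocus X)ᶜ.Finite)
    (hchart : ∀ x : X, x ∉ Scheme.regularLocus X →
      ∃ (Y : Scheme.{0}) (φ : Y ⟶ X) (_ : Etale φ) (y : Y) (_ : φ y = x) (_ : IsClosed ({y} : Set Y))
        (_ : ∀ c : Y.presheaf.stalk y, ∃ b : X.presheaf.stalk (φ y),
          c - (φ.stalkMap y).hom b ∈ IsLocalRing.maximalIdeal (Y.presheaf.stalk y))
        (V : Y.Opens) (hV : IsAffineOpen V) (hyV : y ∈ V) (_ : IsNoetherianRing Γ(Y, V))
        (n : ℕ) (P : AddSubmonoid (Fin n → ℤ)) (hP : P.FG)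
        (_ : ∀ (v : Fin n → ℤ) (k : ℕ), 0 < k → k • v ∈ P → v ∈ P)
        (hspan : Submodule.span ℤ (P : Set (Fin n → ℤ)) = ⊤)
        (ψ : Multiplicative P →* Γ(Y, V)),
        (∀ (𝔭 : Ideal Γ(Y, V)) [𝔭.IsPrime], IsLogRegularAt P ψ 𝔭) ∧
        (∀ p : P, (p : Fin n → ℤ) ≠ 0 → ψ (Multiplicative.ofAdd p) ∈ (hV.primeIdealOf ⟨y, hyV⟩).asIdeal) ∧
        ringKrullDim (Localization.AtPrime (hV.primeIdealOf ⟨y, hyV⟩).asIdeal) = n ∧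
        (∀ (𝔓 : Ideal Γ(Y, V)) [𝔓.IsPrime], 𝔓 ≠ (hV.primeIdealOf ⟨y, hyV⟩).asIdeal →
          IsRegularLocalRing (Localization.AtPrime 𝔓)) ∧
        (Fan.ofCone (dualCone P) (dualCone_fg P hP) (isSalient_dualCone P hspan)).IsPrimSimplicial ∧
        ¬ (Fan.ofCone (dualCone P) (dualCone_fg P hP) (isSalient_dualCone P hspan)).IsRegular) :
    Scheme.HasResolution X := by
  classical
  refine EtaleChartPrimaryCentre.hasResolution_of_isolated_etale_primaryBlowup K X f hfin fun x hx => ?_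
  obtain ⟨Y, φ, _, y, hyx, hycl, hres, V, hV, hyV, _, n, P, hP, hsat, hspan, ψ, hreg, hfix, hdim, hisol, hps, hnreg⟩ :=
    hchart x hx
  subst hyx
  refine ⟨Y, φ, inferInstance, y, rfl, hres, ?_⟩
  set 𝔮 := hV.primeIdealOf ⟨y, hyV⟩ with h𝔮def
  haveI h𝔮max : 𝔮.asIdeal.IsMaximal := hV.primeIdealOf_isMaximal_of_isClosed ⟨y, hyV⟩ hycl
  -- the Kato ideal localizes to `𝔮`
  have hI𝔮 := exists_mul_mem_ideal_of_isLogRegularAt_of_ringKrullDim_eq (hreg 𝔮.asIdeal) hfix hdim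
  -- the `𝔮`-primary monomial centre with regular blow-up
  obtain ⟨s, -, hregJ, hJ𝔮, g, hg𝔮, hpow⟩ :=
    PrimaryCentreAtIsolatedPointFan.exists_primary_monomialCentre_of_isolated' hP hsat hspan hreg 𝔮.asIdeal hfix hI𝔮
      hisol hps hnreg
  set J := Ideal.span ((fun p : P => ψ (Multiplicative.ofAdd p)) '' (s : Set P)) with hJdef
  -- pass to the basic open `D(g) ∋ y`
  have hyg : y ∈ Y.basicOpen g := by
    letI := Y.presheaf.algebra_section_stalk ⟨y, hyV⟩
    haveI := hV.isLocalization_stalk ⟨y, hyV⟩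
    rw [Scheme.mem_basicOpen (hx := hyV)]
    have hng : algebraMap Γ(Y, V) (Y.presheaf.stalk y) g ∉ IsLocalRing.maximalIdeal _ := by
      rw [IsLocalization.AtPrime.to_map_mem_maximal_iff (Y.presheaf.stalk y) 𝔮.asIdeal]; exact hg𝔮
    exact not_not.1 fun h => hng ((IsLocalRing.mem_maximalIdeal _).2 h)
  have hV' : IsAffineOpen (Y.basicOpen g) := hV.basicOpen g
  haveI hlocg : IsLocalization.Away g Γ(Y, Y.basicOpen g) := hV.isLocalization_basicOpen g
  set 𝔮' := hV'.primeIdealOf ⟨y, hyg⟩ with h𝔮'def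
  have hQQ : 𝔮'.asIdeal.comap (algebraMap Γ(Y, V) Γ(Y, Y.basicOpen g)) = 𝔮.asIdeal := by
    ext t
    letI := Y.presheaf.algebra_section_stalk ⟨y, hyV⟩
    haveI := hV.isLocalization_stalk ⟨y, hyV⟩
    letI := Y.presheaf.algebra_section_stalk (U := Y.basicOpen g) ⟨y, hyg⟩
    haveI := hV'.isLocalization_stalk ⟨y, hyg⟩
    rw [Ideal.mem_comap,
      ← IsLocalization.AtPrime.to_map_mem_maximal_iff (Y.presheaf.stalk y) 𝔮'.asIdeal,
      ← IsLocalization.AtPrime.to_map_mem_maximal_iff (Y.presheaf.stalk y) 𝔮.asIdeal]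
    change (Y.presheaf.germ (Y.basicOpen g) y hyg).hom
        ((Y.presheaf.map (homOfLE (Y.basicOpen_le g)).op).hom t) ∈ _ ↔
      (Y.presheaf.germ V y hyV).hom t ∈ _
    rw [TopCat.Presheaf.germ_res_apply]
  have hQ'eq : 𝔮'.asIdeal = 𝔮.asIdeal.map (algebraMap Γ(Y, V) Γ(Y, Y.basicOpen g)) := by
    rw [← hQQ]
    exact (IsLocalization.map_under (Submonoid.powers g) Γ(Y, Y.basicOpen g) 𝔮'.asIdeal).symm
  obtain ⟨N, hN⟩ := hpow Γ(Y, Y.basicOpen g)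
  set J' : Ideal Γ(Y, Y.basicOpen g) := J.map (algebraMap Γ(Y, V) Γ(Y, Y.basicOpen g)) with hJ'def
  refine ⟨Y.basicOpen g, hV', hyg, J', N, ?_, ?_, ?_⟩
  · rw [hQ'eq]; exact hN
  · rw [hQ'eq]; exact Ideal.map_mono hJ𝔮
  · haveI : IsOpenImmersion (Spec.map (CommRingCat.ofHom (algebraMap Γ(Y, V) Γ(Y, Y.basicOpen g)))) :=
      IsOpenImmersion.of_isLocalization g
    exact BlowupFlatCriteria.isRegular_affineBlowup_map_of_isOpenImmersion _ J hregJ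


/-- **(ε₂″, any field) Isolated singularities that are étale-locally points of AFFINE log regular charts (unit face `0`,
primitively simplicial fan) WITH TRIVIAL RESIDUE EXTENSION are resolvable.** As
`…IsolatedAffineLogRegularChartResolution.hasResolution_of_isolated_affine_logRegular_charts_of_isAlgClosed'`, over an arbitrary field,
with the residue condition as hypothesis. [cite: Kato1994, Def. (2.1), (6.1), (10.4)] [cite: Kollar2007, §2.2] -/
theorem hasResolution_of_isolated_affine_logRegular_charts (K : Type) [Field K]
    (X : Scheme.{0}) [IsIntegral X] (f : X ⟶ Spec (.of K)) [LocallyOfFiniteType f]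
    (hfin : (Scheme.regularLocus X)ᶜ.Finite)
    (hchart : ∀ x : X, x ∉ Scheme.regularLocus X →
      ∃ (R : CommRingCat.{0}) (φ : Spec R ⟶ X) (_ : Etale φ) (y : Spec R) (_ : φ y = x)
        (_ : ∀ c : (Spec R).presheaf.stalk y, ∃ b : X.presheaf.stalk (φ y),
          c - (φ.stalkMap y).hom b ∈ IsLocalRing.maximalIdeal ((Spec R).presheaf.stalk y))
        (n : ℕ) (P : AddSubmonoid (Fin n → ℤ)) (hP : P.FG)
        (_ : ∀ (v : Fin n → ℤ) (k : ℕ), 0 < k → k • v ∈ P → v ∈ P)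
        (hspan : Submodule.span ℤ (P : Set (Fin n → ℤ)) = ⊤)
        (ψ : Multiplicative P →* R) (g : R),
        g ∉ y.asIdeal ∧
        (∀ (𝔭 : Ideal R) [𝔭.IsPrime], g ∉ 𝔭 → IsLogRegularAt P ψ 𝔭) ∧
        (∀ p : P, (p : Fin n → ℤ) ≠ 0 → ψ (Multiplicative.ofAdd p) ∈ y.asIdeal) ∧
        (Fan.ofCone (dualCone P) (dualCone_fg P hP) (isSalient_dualCone P hspan)).IsPrimSimplicial) :
    Scheme.HasResolution X := by
  classical
  haveI : IsLocallyNoetherian X := LocallyOfFiniteType.isLocallyNoetherian f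
  refine hasResolution_of_isolated_logRegular_fixed_charts K X f hfin fun x hx => ?_
  obtain ⟨R, φ, _, y, hyx, hres, n, P, hP, hsat, hspan, ψ, g, hgy, hreg, hfix, hps⟩ := hchart x hx
  subst hyx
  -- the chart scheme `Y = Spec R`
  haveI : IsLocallyNoetherian (Spec R) := LocallyOfFiniteType.isLocallyNoetherian φ
  haveI : JacobsonSpace (Spec R) := LocallyOfFiniteType.jacobsonSpace (φ ≫ f)
  haveI : LocallyQuasiFinite φ := IsolatedAffineLogRegularChartResolution.locallyQuasiFinite_of_etale φ
  -- (a) `φ y` is closed; an affine open `U ∋ φ y`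
  have hxcl : IsClosed ({φ y} : Set X) := IsolatedClosed.isClosed_singleton_of_finite_singularLocus K X f hfin hx
  obtain ⟨U, hU, hxU, -⟩ := exists_isAffineOpen_mem_and_subset (X := X) (x := φ y) (U := ⊤) trivial
  -- (b) the other singular points form a finite closed set
  set T : Set X := (Scheme.regularLocus X)ᶜ \ {φ y} with hT
  have hTclosed : IsClosed T := by
    rw [← Set.biUnion_of_singleton T]
    exact (hfin.subset fun z hz => hz.1).isClosed_biUnion fun z hz =>
      IsolatedClosed.isClosed_singleton_of_finite_singularLocus K X f hfin hz.1
  -- (c) `y` is isolated in its fibre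
  obtain ⟨u, huopen, hu⟩ := (isDiscrete_iff_forall_mem_exists_isOpen.mp (φ.isDiscrete_preimage_singleton (φ y)))
    y rfl
  -- (d) the open neighbourhood `W` of `y` and a basic open `D(h) ∋ y` inside it
  set W : (Spec R).Opens :=
    ⟨u, huopen⟩ ⊓ φ ⁻¹ᵁ ⟨Tᶜ, hTclosed.isOpen_compl⟩ ⊓ φ ⁻¹ᵁ U ⊓ PrimeSpectrum.basicOpen g with hWdef
  have hyW : y ∈ W := by
    refine ⟨⟨⟨?_, ?_⟩, hxU⟩, (PrimeSpectrum.mem_basicOpen _ _).mpr hgy⟩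
    · simpa [Set.mem_singleton_iff] using (show y ∈ u ∩ φ ⁻¹' {φ y} by rw [hu]; rfl)
    · show φ y ∈ Tᶜ
      exact fun h => h.2 rfl
  obtain ⟨_, ⟨h, rfl⟩, hyh, hhW⟩ := (Opens.isBasis_iff_nbhd.mp PrimeSpectrum.isBasis_basic_opens) hyW
  -- (e) the affine open `V = D(h)` and its coordinate ring
  set V : (Spec R).Opens := PrimeSpectrum.basicOpen h with hVdef
  have hV : IsAffineOpen V := by
    rw [hVdef, ← basicOpen_eq_of_affine]
    exact (isAffineOpen_top (Spec R)).basicOpen _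
  have hyV : y ∈ V := hyh
  have hVW : V ≤ W := hhW
  haveI : IsNoetherianRing Γ(Spec R, V) := IsLocallyNoetherian.component_noetherian ⟨V, hV⟩
  set 𝔮 := hV.primeIdealOf ⟨y, hyV⟩ with h𝔮def
  -- the chart on `Γ(Spec R, D(h))`
  let ψV : Multiplicative P →* Γ(Spec R, V) := (algebraMap R Γ(Spec R, V)).toMonoidHom.comp ψ
  have hregV : ∀ (𝔓 : Ideal Γ(Spec R, V)) [𝔓.IsPrime], IsLogRegularAt P ψV 𝔓 := by
    intro 𝔓 _
    refine FixedPointResolvableNhd.isLogRegularAt_of_isLocalization (Submonoid.powers h) P ψ 𝔓 (hreg _ ?_)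
    -- `g ∉ 𝔓 ∩ R` since `D(h) ⊆ D(g)`
    have hh𝔓 : h ∉ 𝔓.comap (algebraMap R Γ(Spec R, V)) := fun hh =>
      ‹𝔓.IsPrime›.ne_top (Ideal.eq_top_of_isUnit_mem _ (Ideal.mem_comap.mp hh)
        (IsLocalization.Away.algebraMap_isUnit h))
    have hmem : (⟨𝔓.comap (algebraMap R Γ(Spec R, V)), inferInstance⟩ : PrimeSpectrum R) ∈ V :=
      (PrimeSpectrum.mem_basicOpen _ _).mpr hh𝔓
    exact (PrimeSpectrum.mem_basicOpen _ _).mp (hVW hmem).2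
  have hfixV : ∀ p : P, (p : Fin n → ℤ) ≠ 0 → ψV (Multiplicative.ofAdd p) ∈ 𝔮.asIdeal := fun p hp =>
    (IsolatedAffineLogRegularChartResolution.algebraMap_mem_primeIdealOf_iff hV hyV _).mpr (hfix p hp)
  -- (f) every other point of `V` is a regular point
  have hV_W : ∀ {z : Spec R}, z ∈ V → z ≠ y → z ∈ Scheme.regularLocus (Spec R) := by
    intro z hzV hzy
    have hzW : z ∈ W := hVW hzV
    have hφz : φ z ≠ φ y := fun hzz => hzy (by
      have : z ∈ u ∩ φ ⁻¹' {φ y} := ⟨hzW.1.1.1, hzz⟩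
      rw [hu] at this
      exact this)
    have hφreg : φ z ∈ Scheme.regularLocus X := by
      by_contra hc
      exact (show φ z ∈ Tᶜ from hzW.1.1.2) ⟨hc, hφz⟩
    rw [Scheme.mem_regularLocus] at hφreg ⊢
    exact (isRegularLocalRing_stalk_iff_of_etale φ z).mpr hφreg
  have hisolV : ∀ (𝔓 : Ideal Γ(Spec R, V)) [𝔓.IsPrime], 𝔓 ≠ 𝔮.asIdeal →
      IsRegularLocalRing (Localization.AtPrime 𝔓) := by
    intro 𝔓 _ hne
    set z : PrimeSpectrum Γ(Spec R, V) := ⟨𝔓, inferInstance⟩ with hzdef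
    have hzV : hV.fromSpec z ∈ V := hV.range_fromSpec.le ⟨z, rfl⟩
    have hzy : hV.fromSpec z ≠ y := fun hzy => hne (by
      have h2 : hV.fromSpec z = hV.fromSpec 𝔮 := by rw [hzy, h𝔮def, hV.fromSpec_primeIdealOf ⟨y, hyV⟩]
      exact congrArg PrimeSpectrum.asIdeal (hV.fromSpec.isOpenEmbedding.injective h2))
    have hz := hV_W hzV hzy
    rw [mem_regularLocus_fromSpec_iff hV, mem_regularLocus] at hz
    exact hz
  -- (g) the face fan is not regular: else `y`, hence `φ y`, would be a regular point
  have hnregV : ¬ (Fan.ofCone (dualCone P) (dualCone_fg P hP) (isSalient_dualCone P hspan)).IsRegular := by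
    intro hΔ
    have hregq : IsRegularLocalRing (Localization.AtPrime 𝔮.asIdeal) :=
      isRegularLocalRing_of_isRegular_ofCone hP hsat hspan (hregV 𝔮.asIdeal) hfixV hΔ
    have hyreg : y ∈ Scheme.regularLocus (Spec R) := by
      have h1 := (mem_regularLocus_fromSpec_iff hV 𝔮).mpr ((mem_regularLocus 𝔮).mpr hregq)
      rwa [h𝔮def, hV.fromSpec_primeIdealOf ⟨y, hyV⟩] at h1
    rw [Scheme.mem_regularLocus] at hyreg
    exact hx ((Scheme.mem_regularLocus _).mpr ((isRegularLocalRing_stalk_iff_of_etale φ y).mp hyreg))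
  -- (g′) `dim Γ(Spec R, V)_𝔮 = n`, DERIVED: the Kato ideal is `𝔮`-primary at an isolated singular fixed point (κ″)
  have hdimV : ringKrullDim (Localization.AtPrime 𝔮.asIdeal) = n :=
    RegularPointRegularCone.ringKrullDim_eq_of_isolated hP hsat hspan hregV 𝔮.asIdeal hfixV hisolV hnregV
  -- (h) `y` is a closed point: `𝔮` is maximal (unramified over the maximal ideal of `φ y`), and `Spec R` is Jacobson
  have h𝔮max : 𝔮.asIdeal.IsMaximal := by
    set 𝔭 := hU.primeIdealOf ⟨φ y, hxU⟩ with h𝔭def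
    haveI h𝔭max : 𝔭.asIdeal.IsMaximal := hU.primeIdealOf_isMaximal_of_isClosed ⟨φ y, hxU⟩ hxcl
    have eVU : V ≤ φ ⁻¹ᵁ U := fun z hz => (hVW hz).1.2
    have hψ' : (φ.appLE U V eVU).hom.Etale := φ.etale_appLE hU hV eVU
    letI : Algebra Γ(X, U) Γ(Spec R, V) := (φ.appLE U V eVU).hom.toAlgebra
    haveI : Algebra.Etale Γ(X, U) Γ(Spec R, V) := hψ'
    have hcomap : 𝔮.asIdeal.comap (algebraMap Γ(X, U) Γ(Spec R, V)) = 𝔭.asIdeal :=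
      congrArg PrimeSpectrum.asIdeal (hU.comap_primeIdealOf_appLE (f := φ) U V hV eVU hyV)
    exact EtaleChartPrimaryCentreAlgClosed.isMaximal_of_isMaximal_comap_of_formallyUnramified 𝔮.asIdeal
      (hcomap ▸ h𝔭max)
  have hycl : IsClosed ({y} : Set (Spec R)) := by
    have h1 : IsClosed ({𝔮} : Set (PrimeSpectrum Γ(Spec R, V))) :=
      (PrimeSpectrum.isClosed_singleton_iff_isMaximal 𝔮).mpr h𝔮max
    have h2 : 𝔮 ∈ hV.fromSpec ⁻¹' closedPoints (Spec R) := by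
      rw [hV.fromSpec.isOpenEmbedding.preimage_closedPoints]
      exact h1
    have h3 : hV.fromSpec 𝔮 ∈ closedPoints (Spec R) := h2
    rw [h𝔮def, hV.fromSpec_primeIdealOf ⟨y, hyV⟩] at h3
    exact h3
  -- (i) assemble (ε₂′)'s chart data
  exact ⟨Spec R, φ, inferInstance, y, rfl, hycl, hres, V, hV, hyV, inferInstance, n, P, hP, hsat, hspan, ψV,
    hregV, hfixV, hdimV, hisolV, hps, hnregV⟩


end Summit.ResolutionOfSingularities.ResolutionOfSingularities.Theorems.FRationalResolution.IsolatedChartResolutionField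

end
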